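import Summits.AnomalousDissipation.AnomalousDissipation.Theorems.BaireTransferRobustLoudUpgradeStubSteadyPersist
import Summits.AnomalousDissipation.AnomalousDissipation.Theorems.BaireTransferRobustLoudUpgradeStubBorderedCone
import Literature.Analysis.FunctionSpaces.TorusHolderSobolevEmbedding

/-!
# Stub `stub_subharmonicSign` of the line `malkin-cone-group-orbits` (crux `BaireTransfer.RobustLoudUpgrade`,
# stmt-AnomalousDissipation-1144, companion lead c2 "Lyapunov–Schmidt crossing"): the ℤ₂ member

Registered stub (Pi-form), proved here textually: if the force `f_c := force S c` and the steady witness `u₀`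
are `b`-PERIODIC under a lattice translation `y ↦ y + b` of `T³`, the kernel field `v` and the border field `h`
are `b`-ANTIperiodic, and the real Lyapunov–Schmidt function `σ(c, ·)` is pinned by the family clause at
`c' = c` (for every `δ > 0`, for `|x|` small, `|σ(c,x)| < δ` and the corrected force `f_c − σ(c,x) h` carries a
mean-zero classical steady state `u'`, lattice-close to `u₀`, of phase `∫⟪v, u' − u₀⟫ = x`) and by its
uniqueness clause (radius `ρ`), then `σ(c, ·)` is ODD near `0`:
`∃ r₀ > 0, ∀ x, |x| < r₀ → σ (c, -x) = -σ (c, x)`.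

Content and proof idea (pure symmetry bookkeeping; Vanderbauwhede, *Local Bifurcation and Symmetry* (1982),
Ch. 8 — equivariance of the Lyapunov–Schmidt reduction; Chow–Hale, *Methods of Bifurcation Theory* (1982),
Ch. 6).  The translation `(T_b u)(y) = u (y + b)` maps classical steady states of a force `F` to classical
steady states of `F(· + b)` (the steady Navier–Stokes system on the torus is translation covariant; tree
theorem `BorderedCone.translate_isClassical`).  Take the family member `(u', p')` at `x` (with `δ := ρ`):
* force algebra: `f_c(y + b) − σ(c,x) h(y + b) = f_c(y) − (−σ(c,x)) h(y)`;
* mean: `∫ u'(· + b) = ∫ u' = 0` (invariance of the Haar measure, `integral_add_right_eq_self`);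
* lattice distance: `𝓕(u'(· + b))(k) = e_k(b) 𝓕(u')(k)` (`Torus.mFourierCoeff_comp_add_right`) and, `u₀` being
  `b`-periodic, `𝓕(u₀)(k) = e_k(b) 𝓕(u₀)(k)`; since `|e_k(b)| = 1` every term of the weighted sum is unchanged;
* phase: `⟪v(y), u'(y + b) − u₀(y)⟫ = −⟪v(y + b), u'(y + b) − u₀(y + b)⟫`, so the phase of `T_b u'` is `−x`.
Uniqueness at `(−x, −σ(c,x))` (both of size `< ρ` once `|x| < min r ρ`) gives `−σ(c,x) = σ(c,−x)`.

Pure proof file (no definitions); the hypotheses `IsSmooth u₀`, `IsSmooth v` of the registered signature are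
not needed by the argument.
-/

-- `Summit.<Summit>.<Problem>` is the tree's mandated summit-side namespace (CONVENTIONS §2); for this
-- single-conjunct summit the two coincide, so the duplicate is deliberate.
set_option linter.dupNamespace false

noncomputable section

open scoped BigOperators Topology
open Filter Set Function TopologicalSpace MeasureTheory UnitAddTorus

namespace Summit.AnomalousDissipation.AnomalousDissipation.Theorems.RobustLoudUpgrade.SubharmonicSign

open Summit.AnomalousDissipation.AnomalousDissipation.Theorems.RobustLoudUpgrade
open Literature.Analysis.FunctionSpaces Literature.Analysis.FunctionSpaces.Torus
open Literature.Analysis.FunctionSpaces.EuclideanSpace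
open Literature.Analysis.FluidPDE

/-! ## §1 Translation covariance of the data of a family member -/

section Translate

variable {u u₀ v : UnitAddTorus (Fin 3) → EuclideanSpace ℝ (Fin 3)} {b : UnitAddTorus (Fin 3)}

/-- **Space translation of a classical steady state**: if `(u, p)` is a classical steady state of `NS_ν`
forced by `f`, then `(u, p)(· + b)` is one for the force `f(· + b)` (steady case of the tree theorem
`BorderedCone.translate_isClassical`, pattern of `Cruxes/RobustLoudUpgrade/Disproof.lean` §11). [folklore] -/
theorem isSteadyNSState_translate {ν : ℝ} {f : UnitAddTorus (Fin 3) → EuclideanSpace ℝ (Fin 3)}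
    {p : UnitAddTorus (Fin 3) → ℝ} (hst : Torus.IsSteadyNSState ν f u p) (b : UnitAddTorus (Fin 3)) :
    Torus.IsSteadyNSState ν (fun y => f (y + b)) (fun y => u (y + b)) (fun y => p (y + b)) :=
  BorderedCone.translate_isClassical hst b

/-- Zero mean is preserved by space translations (invariance of the Haar measure). [folklore] -/
theorem hasZeroMean_translate (h0 : HasZeroMean u) (b : UnitAddTorus (Fin 3)) :
    HasZeroMean (fun y => u (y + b)) := by
  unfold HasZeroMean at h0 ⊢
  rw [integral_add_right_eq_self (μ := (volume : Measure (UnitAddTorus (Fin 3)))) u b]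
  exact h0

/-- **The lattice distance to a `b`-periodic field is translation invariant, termwise**: the Fourier
coefficients of `u(· + b)` are `e_k(b) • û(k)`, those of the `b`-periodic `u₀` satisfy `û₀(k) = e_k(b) • û₀(k)`,
and `|e_k(b)| = 1`. [folklore] -/
theorem norm_mFourierCoeff_translate_sub (hu₀ : ∀ y, u₀ (y + b) = u₀ y) (k : Fin 3 → ℤ) :
    ‖mFourierCoeff (complexify ∘ fun y => u (y + b)) k - mFourierCoeff (complexify ∘ u₀) k‖ =
      ‖mFourierCoeff (complexify ∘ u) k - mFourierCoeff (complexify ∘ u₀) k‖ := by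
  have h1 : (complexify ∘ fun y => u (y + b) : UnitAddTorus (Fin 3) → EuclideanSpace ℂ (Fin 3)) =
      fun y => (complexify ∘ u) (y + b) := rfl
  have h2 : (fun y => (complexify ∘ u₀) (y + b) : UnitAddTorus (Fin 3) → EuclideanSpace ℂ (Fin 3)) =
      complexify ∘ u₀ := by
    funext y
    simp only [Function.comp_apply, hu₀ y]
  -- `h3 : 𝓕(u₀)(k) = e_k(b) • 𝓕(u₀)(k)`
  have h3 := Torus.mFourierCoeff_comp_add_right
    (complexify ∘ u₀ : UnitAddTorus (Fin 3) → EuclideanSpace ℂ (Fin 3)) b k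
  rw [h2] at h3
  rw [h1, Torus.mFourierCoeff_comp_add_right]
  conv_lhs => rw [h3]
  rw [← smul_sub, norm_smul, Torus.norm_mFourier_apply, one_mul]

/-- **The phase of a translate**: with `u₀` `b`-periodic and `v` `b`-antiperiodic,
`∫⟪v, u(· + b) − u₀⟫ = −∫⟪v, u − u₀⟫`. [folklore] -/
theorem integral_inner_translate (hu₀ : ∀ y, u₀ (y + b) = u₀ y) (hv : ∀ y, v (y + b) = -v y) :
    (∫ y, inner ℝ (v y) (u (y + b) - u₀ y)) = -∫ y, inner ℝ (v y) (u y - u₀ y) := by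
  have h1 : (fun y => inner ℝ (v y) (u (y + b) - u₀ y)) =
      fun y => -(fun z => inner ℝ (v z) (u z - u₀ z)) (y + b) := by
    funext y
    have hv' : v y = -v (y + b) := by rw [hv, neg_neg]
    have hu' : u₀ y = u₀ (y + b) := (hu₀ y).symm
    rw [hv', hu', inner_neg_left]
  rw [h1, integral_neg, integral_add_right_eq_self (μ := (volume : Measure (UnitAddTorus (Fin 3))))
    (fun z => inner ℝ (v z) (u z - u₀ z)) b]

end Translate

/-! ## §2 The registered stub -/

/-- **stub_subharmonicSign** (pure symmetry bookkeeping).  If `f_c` and `u₀` are `b`-periodic, the kernel field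
`v` and the border field `h` are `b`-antiperiodic, and `σ(c, ·)` is pinned by the Lyapunov–Schmidt family at
`c' = c` (existence of the corrected steady states, lattice-close to `u₀`, of phase `x`) and by its uniqueness
clause, then `σ(c, ·)` is ODD near `0`: translate the family member at `x` by `b`; it is a mean-zero steady state
of `f_c − (−σ(c,x)) h`, lattice-close to `u₀` (the Fourier coefficients only pick up the phases `e_k(b)`, which
`û₀` absorbs), of phase `−x`; uniqueness gives `σ(c, −x) = −σ(c, x)` (Vanderbauwhede 1982, Ch. 8; Chow–Hale 1982,
Ch. 6). [folklore] -/
theorem stub_subharmonicSign :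
    ∀ (S : Finset (Fin 3 → ℤ)) (c : Coeff S) (ν : ℝ) (b : UnitAddTorus (Fin 3))
      (u₀ v h : UnitAddTorus (Fin 3) → EuclideanSpace ℝ (Fin 3)) (σ : Coeff S × ℝ → ℝ) (ρ : ℝ),
      (∀ y, force S c (y + b) = force S c y) → (∀ y, u₀ (y + b) = u₀ y) → (∀ y, v (y + b) = -v y) →
      (∀ y, h (y + b) = -h y) → IsSmooth u₀ → IsSmooth v →
      (∀ δ : ℝ, 0 < δ → ∃ r : ℝ, 0 < r ∧ ∀ x : ℝ, |x| < r → |σ (c, x)| < δ ∧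
        ∃ (u' : UnitAddTorus (Fin 3) → EuclideanSpace ℝ (Fin 3)) (p' : UnitAddTorus (Fin 3) → ℝ),
          Torus.IsSteadyNSState ν (fun y => force S c y - σ (c, x) • h y) u' p' ∧ HasZeroMean u' ∧
            (∑' k : Fin 3 → ℤ, freqNormSq k ^ 2 *
                ‖mFourierCoeff (complexify ∘ u') k - mFourierCoeff (complexify ∘ u₀) k‖ ^ 2) < δ ∧
            (∫ y, inner ℝ (v y) (u' y - u₀ y)) = x) →
      0 < ρ →
      (∀ (x t : ℝ) (u'' : UnitAddTorus (Fin 3) → EuclideanSpace ℝ (Fin 3)) (p'' : UnitAddTorus (Fin 3) → ℝ),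
        |x| < ρ → |t| < ρ →
        Torus.IsSteadyNSState ν (fun y => force S c y - t • h y) u'' p'' → HasZeroMean u'' →
        (∑' k : Fin 3 → ℤ, freqNormSq k ^ 2 *
            ‖mFourierCoeff (complexify ∘ u'') k - mFourierCoeff (complexify ∘ u₀) k‖ ^ 2) < ρ →
        (∫ y, inner ℝ (v y) (u'' y - u₀ y)) = x → t = σ (c, x)) →
      ∃ r₀ : ℝ, 0 < r₀ ∧ ∀ x : ℝ, |x| < r₀ → σ (c, -x) = -σ (c, x) := by
  intro S c ν b u₀ v h σ ρ hf hu₀ hv hh _hu₀s _hvs hfam hρ huniq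
  obtain ⟨r, hr, hmem⟩ := hfam ρ hρ
  refine ⟨min r ρ, lt_min hr hρ, fun x hx => ?_⟩
  have hxr : |x| < r := lt_of_lt_of_le hx (min_le_left _ _)
  have hxρ : |x| < ρ := lt_of_lt_of_le hx (min_le_right _ _)
  obtain ⟨hσ, u', p', hst, hm, hlat, hph⟩ := hmem x hxr
  refine (huniq (-x) (-σ (c, x)) (fun y => u' (y + b)) (fun y => p' (y + b)) (by rwa [abs_neg])
    (by rwa [abs_neg]) ?_ (hasZeroMean_translate hm b) ?_ ?_).symm
  · -- the translate is a steady state of the force corrected by `−σ(c,x)`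
    have e : (fun y => force S c y - (-σ (c, x)) • h y) =
        fun y => (fun z => force S c z - σ (c, x) • h z) (y + b) := by
      funext y
      simp only [hf y, hh y, smul_neg, neg_smul]
    rw [e]
    exact isSteadyNSState_translate hst b
  · -- the lattice distance to `u₀` is unchanged
    calc (∑' k : Fin 3 → ℤ, freqNormSq k ^ 2 *
          ‖mFourierCoeff (complexify ∘ fun y => u' (y + b)) k - mFourierCoeff (complexify ∘ u₀) k‖ ^ 2)
        = ∑' k : Fin 3 → ℤ, freqNormSq k ^ 2 *
            ‖mFourierCoeff (complexify ∘ u') k - mFourierCoeff (complexify ∘ u₀) k‖ ^ 2 :=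
          tsum_congr fun k => by rw [norm_mFourierCoeff_translate_sub hu₀]
      _ < ρ := hlat
  · -- the phase flips sign
    show (∫ y, inner ℝ (v y) (u' (y + b) - u₀ y)) = -x
    rw [integral_inner_translate hu₀ hv, hph]

end Summit.AnomalousDissipation.AnomalousDissipation.Theorems.RobustLoudUpgrade.SubharmonicSign

end
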